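import Summits.QuantumFields.QCD.Theses.SpectralDefectExtinction
import Summits.QuantumFields.QCD.Theorems.NestedDissectionSeaRobustYangMillsRGStubFormatBallClusteringFalseAux4
import Literature.MathematicalPhysics.QuantumFieldTheory.QCDPhaseQuenched

/-!
# Single-link resonance (S2c of line `corner-decorrelation-deep-hole`): the Wilson action along a
one-link circle is a degree-one trigonometric polynomial with bounded oscillation
(crux `Summit.QuantumFields.QCD.Theses.SpectralDefectExtinction.WindowExtinction`, item stmt-QuantumFields-18063)

Brick C of the registered stub `stub_singleLinkResonance`.  Rotating ONE link `e` of an `SU(3)` gauge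
field `U` on the four-torus of side `L ≥ 2` along a degree-one trigonometric curve
`c(t) = δ₀ + cos t δ₁ + sin t δ₂` (the eight `su(3)` basis circles, `coareaWegner_su3Circles`):

* `cornerSL_wilsonAction_circle` — `S_W(U[e ↦ U(e)c(t)]) = a + b cos t + c sin t` with `|b|, |c| ≤ 288`:
  every plaquette contains the link at most once (this is where `L ≥ 2` enters), so its cost is affine in
  the link matrix or in its adjoint; the oscillation bound is the landed one-link variation bound
  `SignedFormat.abs_wilsonAction_sub_le` (`≤ 576`) evaluated at `t = 0, π` and `t = ±π/2`;
* `cornerSL_boltzmann_circle` — consequently the Boltzmann factor along the circle is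
  `exp(−β S_W(U[e ↦ U(e)c(t)])) = exp (A + κ cos (t − t₀))` with `0 ≤ κ ≤ 408 β` — the input `κ` of the
  weight sup bound `cornerSL_weight_sup` (brick A).
-/

noncomputable section

namespace Summit.QuantumFields.QCD.Cruxes.WindowExtinction.CornerDecorrelationDeepHole

open scoped BigOperators Matrix Real
open Matrix
open Literature.MathematicalPhysics.QuantumLattice Literature.MathematicalPhysics.QuantumFieldTheory
  Literature.Probability.LatticeModels

/-! ### Degree-one trigonometric matrix families -/

section TrigAffine

variable {F : ℝ → Matrix (Fin 3) (Fin 3) ℂ}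

/-- Right multiplication by a constant matrix preserves degree-one trigonometric families. -/
theorem cornerSL_trig_mul_const (P : Matrix (Fin 3) (Fin 3) ℂ)
    (hF : ∃ M₀ M₁ M₂ : Matrix (Fin 3) (Fin 3) ℂ, ∀ t : ℝ,
      F t = M₀ + ((Real.cos t : ℝ) : ℂ) • M₁ + ((Real.sin t : ℝ) : ℂ) • M₂) :
    ∃ M₀ M₁ M₂ : Matrix (Fin 3) (Fin 3) ℂ, ∀ t : ℝ,
      F t * P = M₀ + ((Real.cos t : ℝ) : ℂ) • M₁ + ((Real.sin t : ℝ) : ℂ) • M₂ := by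
  obtain ⟨M₀, M₁, M₂, h⟩ := hF
  exact ⟨M₀ * P, M₁ * P, M₂ * P, fun t => by rw [h t, Matrix.add_mul, Matrix.add_mul, Matrix.smul_mul,
    Matrix.smul_mul]⟩

/-- Left multiplication by a constant matrix preserves degree-one trigonometric families. -/
theorem cornerSL_trig_const_mul (P : Matrix (Fin 3) (Fin 3) ℂ)
    (hF : ∃ M₀ M₁ M₂ : Matrix (Fin 3) (Fin 3) ℂ, ∀ t : ℝ,
      F t = M₀ + ((Real.cos t : ℝ) : ℂ) • M₁ + ((Real.sin t : ℝ) : ℂ) • M₂) :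
    ∃ M₀ M₁ M₂ : Matrix (Fin 3) (Fin 3) ℂ, ∀ t : ℝ,
      P * F t = M₀ + ((Real.cos t : ℝ) : ℂ) • M₁ + ((Real.sin t : ℝ) : ℂ) • M₂ := by
  obtain ⟨M₀, M₁, M₂, h⟩ := hF
  exact ⟨P * M₀, P * M₁, P * M₂, fun t => by rw [h t, Matrix.mul_add, Matrix.mul_add, Matrix.mul_smul,
    Matrix.mul_smul]⟩

/-- The real part of the trace of a degree-one trigonometric family is `a + b cos t + c sin t`. -/
theorem cornerSL_trig_re_trace
    (hF : ∃ M₀ M₁ M₂ : Matrix (Fin 3) (Fin 3) ℂ, ∀ t : ℝ,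
      F t = M₀ + ((Real.cos t : ℝ) : ℂ) • M₁ + ((Real.sin t : ℝ) : ℂ) • M₂) :
    ∃ a b c : ℝ, ∀ t : ℝ, (F t).trace.re = a + b * Real.cos t + c * Real.sin t := by
  obtain ⟨M₀, M₁, M₂, h⟩ := hF
  refine ⟨M₀.trace.re, M₁.trace.re, M₂.trace.re, fun t => ?_⟩
  rw [h t, Matrix.trace_add, Matrix.trace_add, Matrix.trace_smul, Matrix.trace_smul, Complex.add_re,
    Complex.add_re, smul_eq_mul, smul_eq_mul, Complex.re_ofReal_mul, Complex.re_ofReal_mul]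
  ring

end TrigAffine

/-! ### Geometry of one plaquette -/

/-- On a torus of side `L ≥ 2` a unit shift moves every site. -/
theorem cornerSL_shift_ne {L : ℕ} (hL : 2 ≤ L) (y : TorusSite 4 L) (k : Fin 4) : Site.shift y k ≠ y := by
  intro h
  haveI : Fact (1 < L) := ⟨hL⟩
  have h2 := congrFun h k
  simp only [Literature.MathematicalPhysics.QuantumFieldTheory.Site.shift, Pi.add_apply, Pi.single_eq_same] at h2
  have h3 : (1 : ZMod L) = 0 := by linear_combination h2
  exact one_ne_zero h3

/-- The inverse of an `SU(3)` element is its adjoint matrix. -/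
theorem cornerSL_coe_inv (g : SU3) : (((g⁻¹ : SU3) : Matrix (Fin 3) (Fin 3) ℂ)) = (g : Matrix (Fin 3) (Fin 3) ℂ)ᴴ := by
  rw [← Matrix.star_eq_inv]
  rfl

/-- **One plaquette along a one-link circle.**  For `L ≥ 2`, every plaquette holonomy of
`U[e ↦ U(e)c(t)]`, with `c` a degree-one trigonometric curve, has `Re tr = a + b cos t + c sin t`:
the link `e` occurs at most once among the four edges of the plaquette. -/
theorem cornerSL_plaquette_circle {L : ℕ} [NeZero L] (hL : 2 ≤ L) (U : GaugeConfig 4 L SU3) (e : Edge 4 L)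
    (c : ℝ → SU3) (δ₀ δ₁ δ₂ : Matrix (Fin 3) (Fin 3) ℂ)
    (hc : ∀ t, ((c t : SU3) : Matrix (Fin 3) (Fin 3) ℂ) =
      δ₀ + ((Real.cos t : ℝ) : ℂ) • δ₁ + ((Real.sin t : ℝ) : ℂ) • δ₂)
    (x : TorusSite 4 L) {i j : Fin 4} (hij : i ≠ j) :
    ∃ a b c' : ℝ, ∀ t : ℝ,
      ((fundamentalRep (Fin 3)) (plaquetteHolonomy (Function.update U e (U e * c t)) x i j)).trace.re =
        a + b * Real.cos t + c' * Real.sin t := by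
  -- the moving link and its inverse are degree-one trigonometric families
  have hmov : ∃ M₀ M₁ M₂ : Matrix (Fin 3) (Fin 3) ℂ, ∀ t : ℝ,
      ((Function.update U e (U e * c t) e : SU3) : Matrix (Fin 3) (Fin 3) ℂ) =
        M₀ + ((Real.cos t : ℝ) : ℂ) • M₁ + ((Real.sin t : ℝ) : ℂ) • M₂ := by
    refine ⟨(U e : Matrix (Fin 3) (Fin 3) ℂ) * δ₀, (U e : Matrix (Fin 3) (Fin 3) ℂ) * δ₁,
      (U e : Matrix (Fin 3) (Fin 3) ℂ) * δ₂, fun t => ?_⟩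
    rw [Function.update_self, Submonoid.coe_mul, hc, Matrix.mul_add, Matrix.mul_add, Matrix.mul_smul,
      Matrix.mul_smul]
  have hinv : ∃ M₀ M₁ M₂ : Matrix (Fin 3) (Fin 3) ℂ, ∀ t : ℝ,
      (((Function.update U e (U e * c t) e)⁻¹ : SU3) : Matrix (Fin 3) (Fin 3) ℂ) =
        M₀ + ((Real.cos t : ℝ) : ℂ) • M₁ + ((Real.sin t : ℝ) : ℂ) • M₂ := by
    refine ⟨δ₀ᴴ * (U e : Matrix (Fin 3) (Fin 3) ℂ)ᴴ, δ₁ᴴ * (U e : Matrix (Fin 3) (Fin 3) ℂ)ᴴ,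
      δ₂ᴴ * (U e : Matrix (Fin 3) (Fin 3) ℂ)ᴴ, fun t => ?_⟩
    rw [cornerSL_coe_inv, Function.update_self, Submonoid.coe_mul, hc, Matrix.conjTranspose_mul,
      Matrix.conjTranspose_add, Matrix.conjTranspose_add, Matrix.conjTranspose_smul,
      Matrix.conjTranspose_smul, Complex.star_def, Complex.conj_ofReal, Complex.conj_ofReal, Matrix.add_mul,
      Matrix.add_mul, Matrix.smul_mul, Matrix.smul_mul]
  have hfix : ∀ e' : Edge 4 L, e' ≠ e → ∀ t : ℝ, Function.update U e (U e * c t) e' = U e' :=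
    fun e' h t => Function.update_of_ne h _ _
  simp only [fundamentalRep_apply, plaquetteHolonomy, Submonoid.coe_mul]
  by_cases h1 : (x, i) = e
  · subst h1
    have h2 : (Site.shift x i, j) ≠ (x, i) := fun h => hij (congrArg Prod.snd h).symm
    have h3 : (Site.shift x j, i) ≠ (x, i) := fun h => cornerSL_shift_ne hL x j (congrArg Prod.fst h)
    have h4 : (x, j) ≠ (x, i) := fun h => hij (congrArg Prod.snd h).symm
    simp only [hfix _ h2, hfix _ h3, hfix _ h4]
    exact cornerSL_trig_re_trace (cornerSL_trig_mul_const _ (cornerSL_trig_mul_const _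
      (cornerSL_trig_mul_const _ hmov)))
  · by_cases h2 : (Site.shift x i, j) = e
    · subst h2
      have h3 : (Site.shift x j, i) ≠ (Site.shift x i, j) := fun h => hij (congrArg Prod.snd h)
      have h4 : (x, j) ≠ (Site.shift x i, j) := fun h => cornerSL_shift_ne hL x i (congrArg Prod.fst h).symm
      simp only [hfix _ h1, hfix _ h3, hfix _ h4]
      exact cornerSL_trig_re_trace (cornerSL_trig_mul_const _ (cornerSL_trig_mul_const _
        (cornerSL_trig_const_mul _ hmov)))
    · by_cases h3 : (Site.shift x j, i) = e
      · subst h3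
        have h4 : (x, j) ≠ (Site.shift x j, i) := fun h => hij (congrArg Prod.snd h).symm
        simp only [hfix _ h1, hfix _ h2, hfix _ h4]
        exact cornerSL_trig_re_trace (cornerSL_trig_mul_const _ (cornerSL_trig_const_mul _ hinv))
      · by_cases h4 : (x, j) = e
        · subst h4
          simp only [hfix _ h1, hfix _ h2, hfix _ h3]
          exact cornerSL_trig_re_trace (cornerSL_trig_const_mul _ hinv)
        · simp only [hfix _ h1, hfix _ h2, hfix _ h3, hfix _ h4]
          exact ⟨_, 0, 0, fun t => by ring⟩

/-! ### The Wilson action along a one-link circle -/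

/-- **The Wilson action along a one-link circle is `a + b cos t + c sin t`** (torus side `L ≥ 2`). -/
theorem cornerSL_wilsonAction_circle_shape {L : ℕ} [NeZero L] (hL : 2 ≤ L) (U : GaugeConfig 4 L SU3)
    (e : Edge 4 L) (c : ℝ → SU3) (δ₀ δ₁ δ₂ : Matrix (Fin 3) (Fin 3) ℂ)
    (hc : ∀ t, ((c t : SU3) : Matrix (Fin 3) (Fin 3) ℂ) =
      δ₀ + ((Real.cos t : ℝ) : ℂ) • δ₁ + ((Real.sin t : ℝ) : ℂ) • δ₂) :
    ∃ a b c' : ℝ, ∀ t : ℝ,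
      wilsonAction (fundamentalRep (Fin 3)) (Function.update U e (U e * c t)) =
        a + b * Real.cos t + c' * Real.sin t := by
  choose a b c' h using fun p : Plaquette 4 L =>
    cornerSL_plaquette_circle hL U e c δ₀ δ₁ δ₂ hc p.1 (ne_of_lt p.2.2)
  refine ⟨∑ p : Plaquette 4 L, (3 - a p), ∑ p : Plaquette 4 L, (-b p), ∑ p : Plaquette 4 L, (-c' p), fun t => ?_⟩
  unfold wilsonAction
  calc ∑ p : Plaquette 4 L, ((3 : ℕ) -
        ((fundamentalRep (Fin 3)) (plaquetteHolonomy (Function.update U e (U e * c t)) p.1 p.2.1.1 p.2.1.2)).trace.re)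
      = ∑ p : Plaquette 4 L, ((3 - a p) + (-b p) * Real.cos t + (-c' p) * Real.sin t) :=
        Finset.sum_congr rfl fun p _ => by rw [h p t]; push_cast; ring
    _ = _ := by rw [Finset.sum_add_distrib, Finset.sum_add_distrib, Finset.sum_mul, Finset.sum_mul]

/-- The one-link variation bound of the Wilson action along the circle: `|S(t) − S(s)| ≤ 576`. -/
theorem cornerSL_wilsonAction_circle_var {L : ℕ} [NeZero L] (U : GaugeConfig 4 L SU3) (e : Edge 4 L)
    (c : ℝ → SU3) (t s : ℝ) :
    |wilsonAction (fundamentalRep (Fin 3)) (Function.update U e (U e * c t)) -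
        wilsonAction (fundamentalRep (Fin 3)) (Function.update U e (U e * c s))| ≤ 576 := by
  have h := Summit.QuantumFields.QCD.Cruxes.RobustYangMillsRG.Birth.SignedFormat.abs_wilsonAction_sub_le
    (d := 4) (L := L) (fundamentalRep (Fin 3)) fundamentalRep_mem_unitaryGroup
    (V := Function.update U e (U e * c s)) (V' := Function.update U e (U e * c t)) e
    fun e' he' => by rw [Function.update_of_ne he', Function.update_of_ne he']
  refine h.trans ?_
  norm_num

/-- **Brick C, quantitative form.**  `S_W(U[e ↦ U(e)c(t)]) = a + b cos t + c sin t` with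
`|b| ≤ 288`, `|c| ≤ 288` (torus side `L ≥ 2`). -/
theorem cornerSL_wilsonAction_circle {L : ℕ} [NeZero L] (hL : 2 ≤ L) (U : GaugeConfig 4 L SU3)
    (e : Edge 4 L) (c : ℝ → SU3) (δ₀ δ₁ δ₂ : Matrix (Fin 3) (Fin 3) ℂ)
    (hc : ∀ t, ((c t : SU3) : Matrix (Fin 3) (Fin 3) ℂ) =
      δ₀ + ((Real.cos t : ℝ) : ℂ) • δ₁ + ((Real.sin t : ℝ) : ℂ) • δ₂) :
    ∃ a b c' : ℝ, |b| ≤ 288 ∧ |c'| ≤ 288 ∧ ∀ t : ℝ,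
      wilsonAction (fundamentalRep (Fin 3)) (Function.update U e (U e * c t)) =
        a + b * Real.cos t + c' * Real.sin t := by
  obtain ⟨a, b, c', h⟩ := cornerSL_wilsonAction_circle_shape hL U e c δ₀ δ₁ δ₂ hc
  refine ⟨a, b, c', ?_, ?_, h⟩
  · have hv := cornerSL_wilsonAction_circle_var U e c 0 π
    rw [h 0, h π, Real.cos_zero, Real.cos_pi, Real.sin_zero, Real.sin_pi] at hv
    have : |2 * b| ≤ 576 := by
      calc |2 * b| = |a + b * 1 + c' * 0 - (a + b * -1 + c' * 0)| := by ring_nf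
        _ ≤ 576 := hv
    rw [abs_mul, abs_two] at this
    linarith
  · have hv := cornerSL_wilsonAction_circle_var U e c (π / 2) (-(π / 2))
    rw [h (π / 2), h (-(π / 2)), Real.cos_neg, Real.sin_neg, Real.cos_pi_div_two, Real.sin_pi_div_two] at hv
    have : |2 * c'| ≤ 576 := by
      calc |2 * c'| = |a + b * 0 + c' * 1 - (a + b * 0 + c' * -1)| := by ring_nf
        _ ≤ 576 := hv
    rw [abs_mul, abs_two] at this
    linarith

/-- **Brick C for the weight sup bound: the Boltzmann factor along a one-link circle.**  For `L ≥ 2`,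
`β ≥ 0`, a gauge field `U`, a link `e` and a degree-one trigonometric link curve `c`, there are `A`, `t₀`
and `0 ≤ κ ≤ 408 β` with `exp(−β S_W(U[e ↦ U(e)c(t)])) = exp (A + κ cos (t − t₀))` for all `t`. -/
theorem cornerSL_boltzmann_circle {L : ℕ} [NeZero L] (hL : 2 ≤ L) (U : GaugeConfig 4 L SU3)
    (e : Edge 4 L) (c : ℝ → SU3) (δ₀ δ₁ δ₂ : Matrix (Fin 3) (Fin 3) ℂ)
    (hc : ∀ t, ((c t : SU3) : Matrix (Fin 3) (Fin 3) ℂ) =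
      δ₀ + ((Real.cos t : ℝ) : ℂ) • δ₁ + ((Real.sin t : ℝ) : ℂ) • δ₂)
    {β : ℝ} (hβ : 0 ≤ β) :
    ∃ A κ t₀ : ℝ, 0 ≤ κ ∧ κ ≤ 408 * β ∧ ∀ t : ℝ,
      Real.exp (-(β * wilsonAction (fundamentalRep (Fin 3)) (Function.update U e (U e * c t)))) =
        Real.exp (A + κ * Real.cos (t - t₀)) := by
  obtain ⟨a, b, c', hb, hc', h⟩ := cornerSL_wilsonAction_circle hL U e c δ₀ δ₁ δ₂ hc
  -- polar form of `(−b, −c)`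
  set w : ℂ := ⟨-b, -c'⟩ with hw
  set R : ℝ := ‖w‖ with hR
  have hR0 : 0 ≤ R := norm_nonneg w
  have hRcos : R * Real.cos (Complex.arg w) = -b := by
    rw [hR, Complex.norm_mul_cos_arg]
  have hRsin : R * Real.sin (Complex.arg w) = -c' := by
    rw [hR, Complex.norm_mul_sin_arg]
  have hRle : R ≤ 408 := by
    have hR2 : R ^ 2 = b ^ 2 + c' ^ 2 := by
      rw [hR, Complex.sq_norm, Complex.normSq_apply, hw]
      ring
    have hb2 : b ^ 2 ≤ 288 ^ 2 := by
      rw [← sq_abs]; exact pow_le_pow_left₀ (abs_nonneg b) hb 2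
    have hc2 : c' ^ 2 ≤ 288 ^ 2 := by
      rw [← sq_abs]; exact pow_le_pow_left₀ (abs_nonneg c') hc' 2
    nlinarith
  refine ⟨-(β * a), β * R, Complex.arg w, mul_nonneg hβ hR0, by nlinarith, fun t => ?_⟩
  rw [h t, Real.cos_sub]
  congr 1
  have : β * R * (Real.cos t * Real.cos (Complex.arg w) + Real.sin t * Real.sin (Complex.arg w)) =
      β * (Real.cos t * (R * Real.cos (Complex.arg w)) + Real.sin t * (R * Real.sin (Complex.arg w))) := by
    ring
  rw [this, hRcos, hRsin]
  ring

end Summit.QuantumFields.QCD.Cruxes.WindowExtinction.CornerDecorrelationDeepHole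

end
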